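import Literature.LinearAlgebra.Matrix.CentraliserOfSeparableCharpoly
import Mathlib.Algebra.Group.Conj
import HarnessLib

/-!
# Class-enumeration rigidity along a regular torus: `x t x⁻¹ ~_G x′ t x′⁻¹` for ONE regular `t` iff for ALL regular `t′` of the same torus

Topic `NumberTheory/Rogawski1990`; namespace `Literature.NumberTheory.Rogawski1990.TorusClassRigidity`.  THEOREMS ONLY: no definition, no named fact,
no `sorry`, no instance, no notation.  Cell `hodgecm-mathlib` (D-0151), programme P3a, LEAD F0P3a-plan (g9) T8-25 (B) «(T-tr-b)»; feeder of the N6-ns junction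
`Rogawski1990/LocalTransferChartJunctionCM.lean` (F0P2-p02 (g8); ledger F0P3a-p08 (g13) `LEDGER-N6ns-floor1` §2 (G1-iii): along an `H`-box the matched
`G′_v`-classes are `⟦x_k ι(τ_H b) x_k⁻¹⟧`, `k ≤ r`, and one needs them PAIRWISE DISTINCT for every `b` once they are at `b₀`).

THE MATHEMATICS ([Rogawski1990, §3.1 p. 19: the centraliser of a regular semisimple element is a torus]; ten lines of group theory).  In a group `A` with a
subgroup `G`: if `g (x t x⁻¹) g⁻¹ = x′ t x′⁻¹` then `n := x′⁻¹ g x` commutes with `t`; if every element commuting with `t` commutes with `t′` — true in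
`GL_n(R)`, `R ↪ ∏ K_i` a subring of a product of fields, as soon as `charpoly t` is SEPARABLE and `t′ t = t t′` (★
`Matrix.GeneralLinearGroup.commute_of_commute_of_charpoly_separable`; NO regularity is needed on `t′` for this direction) — then THE SAME `g` gives
`g (x t′ x⁻¹) g⁻¹ = x′ t′ x′⁻¹`.  With `t, t′` both separable and commuting the statement is an `iff` (§3 `isConj_conj_iff_of_charpoly_separable`), and for any
family of conjugators `x_k` the enumeration `k ↦ ⟦x_k t x_k⁻¹⟧_G` is injective iff `k ↦ ⟦x_k t′ x_k⁻¹⟧_G` is («the number of `G`-classes met along the torus is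
constant on its regular set», §3 `injective_conjClasses_conj_iff_of_charpoly_separable`).  At the CM place `R = LocalRing L v = ∏_{w ∣ v} L_w` IS a product of
fields (`abbrev`), `ι := RingHom.id`.
HC_CM is proved only modulo the printed citations until rung 0 closes; this file discharges no named fact.

## References
* [Rogawski1990] J. Rogawski, *Automorphic Representations of Unitary Groups in Three Variables*, Ann. of Math. Stud. 123 (1990), §3.1 p. 19, §4.3 p. 43.
-/

set_option autoImplicit false

namespace Literature.NumberTheory.Rogawski1990.TorusClassRigidity

/-! ## §1 Any group: the same conjugator works along the bicommutant -/

section Group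

variable {A : Type*} [Group A]

/-- **If `g (x t x⁻¹) g⁻¹ = x′ t x′⁻¹` and everything commuting with `t` commutes with `t′`, then `g (x t′ x⁻¹) g⁻¹ = x′ t′ x′⁻¹`** — the element
`n := x′⁻¹ g x` commutes with `t`, hence with `t′`. [cite: Rogawski1990, §3.1 p. 19] -/
theorem conj_eq_conj_of_forall_commute {t t' x x' g : A} (h : g * (x * t * x⁻¹) * g⁻¹ = x' * t * x'⁻¹)
    (hZ : ∀ n : A, n * t = t * n → n * t' = t' * n) : g * (x * t' * x⁻¹) * g⁻¹ = x' * t' * x'⁻¹ := by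
  have hn : x'⁻¹ * g * x * t = t * (x'⁻¹ * g * x) := by
    calc x'⁻¹ * g * x * t = x'⁻¹ * (g * (x * t * x⁻¹) * g⁻¹) * (g * x) := by group
      _ = x'⁻¹ * (x' * t * x'⁻¹) * (g * x) := by rw [h]
      _ = t * (x'⁻¹ * g * x) := by group
  have hn' := hZ _ hn
  calc g * (x * t' * x⁻¹) * g⁻¹ = x' * (x'⁻¹ * g * x * t') * (x⁻¹ * g⁻¹) := by group
    _ = x' * (t' * (x'⁻¹ * g * x)) * (x⁻¹ * g⁻¹) := by rw [hn']
    _ = x' * t' * x'⁻¹ := by group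

variable (G : Subgroup A)

/-- **Subgroup form, one direction**: if `x t x⁻¹` and `x′ t x′⁻¹` lie in `G` and are `G`-conjugate, and everything commuting with `t` commutes with `t′`,
then `x t′ x⁻¹`, `x′ t′ x′⁻¹` (assumed in `G`) are `G`-conjugate — by the same element of `G`. [cite: Rogawski1990, §3.1 p. 19] -/
theorem isConj_conj_of_isConj_conj {t t' x x' : A} (hxt : x * t * x⁻¹ ∈ G) (hx't : x' * t * x'⁻¹ ∈ G) (hxt' : x * t' * x⁻¹ ∈ G)
    (hx't' : x' * t' * x'⁻¹ ∈ G) (hZ : ∀ n : A, n * t = t * n → n * t' = t' * n)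
    (h : IsConj (⟨x * t * x⁻¹, hxt⟩ : G) ⟨x' * t * x'⁻¹, hx't⟩) : IsConj (⟨x * t' * x⁻¹, hxt'⟩ : G) ⟨x' * t' * x'⁻¹, hx't'⟩ := by
  obtain ⟨c, hc⟩ := isConj_iff.1 h
  refine isConj_iff.2 ⟨c, Subtype.ext ?_⟩
  have hc' : (c : A) * (x * t * x⁻¹) * (c : A)⁻¹ = x' * t * x'⁻¹ := by
    have := congrArg Subtype.val hc
    simpa only [Subgroup.coe_mul, Subgroup.coe_inv] using this
  have key := conj_eq_conj_of_forall_commute hc' hZ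
  simpa only [Subgroup.coe_mul, Subgroup.coe_inv] using key

/-- **Subgroup form, `iff`**: with the bicommutant hypothesis in both directions (e.g. `t`, `t′` two regular elements of the same torus), `x t x⁻¹ ~_G x′ t x′⁻¹
↔ x t′ x⁻¹ ~_G x′ t′ x′⁻¹`. [cite: Rogawski1990, §3.1 p. 19] -/
theorem isConj_conj_iff_of_forall_commute {t t' x x' : A} (hxt : x * t * x⁻¹ ∈ G) (hx't : x' * t * x'⁻¹ ∈ G) (hxt' : x * t' * x⁻¹ ∈ G)
    (hx't' : x' * t' * x'⁻¹ ∈ G) (hZ : ∀ n : A, n * t = t * n → n * t' = t' * n) (hZ' : ∀ n : A, n * t' = t' * n → n * t = t * n) :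
    IsConj (⟨x * t * x⁻¹, hxt⟩ : G) ⟨x' * t * x'⁻¹, hx't⟩ ↔ IsConj (⟨x * t' * x⁻¹, hxt'⟩ : G) ⟨x' * t' * x'⁻¹, hx't'⟩ :=
  ⟨isConj_conj_of_isConj_conj G hxt hx't hxt' hx't' hZ, isConj_conj_of_isConj_conj G hxt' hx't' hxt hx't hZ'⟩

end Group

/-! ## §2 `GL_n` over a subring of a product of fields: the bicommutant hypothesis from a separable characteristic polynomial -/

section GenLin

variable {n : Type*} [Fintype n] [DecidableEq n] {I : Type*} {K : I → Type*} [∀ i, Field (K i)] {R : Type*} [CommRing R]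
  (ι : R →+* Π i, K i) (hι : Function.Injective ι)

include hι in
/-- **Everything commuting with a separable `t ∈ GL_n(R)` commutes with every `t′` commuting with `t`** (`R ↪ ∏ K_i`; ★
`Matrix.GeneralLinearGroup.commute_of_commute_of_charpoly_separable`: the commutant of `t` is commutative).  No hypothesis on `t′` beyond `t′ t = t t′`.
[cite: Rogawski1990, §3.1 p. 19] -/
theorem forall_commute_of_charpoly_separable {t t' : GL n R} (hsep : (t : Matrix n n R).charpoly.Separable) (htt' : t' * t = t * t') :
    ∀ g : GL n R, g * t = t * g → g * t' = t' * g :=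
  fun _ hg => (Matrix.GeneralLinearGroup.commute_of_commute_of_charpoly_separable ι hι hsep hg htt').eq

end GenLin

/-! ## §3 HEAD: (T-tr-b) conjugacy and class enumeration are rigid along a regular torus -/

section Head

variable {n : Type*} [Fintype n] [DecidableEq n] {I : Type*} {K : I → Type*} [∀ i, Field (K i)] {R : Type*} [CommRing R]
  (ι : R →+* Π i, K i) (hι : Function.Injective ι) (G : Subgroup (GL n R))

include hι in
/-- **(T-tr-b), one direction**: `t` separable, `t′ t = t t′`; `x t x⁻¹, x′ t x′⁻¹, x t′ x⁻¹, x′ t′ x′⁻¹ ∈ G`; then `x t x⁻¹ ~_G x′ t x′⁻¹ ⇒ x t′ x⁻¹ ~_G x′ t′ x′⁻¹`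
(SAME conjugator). [cite: Rogawski1990, §3.1 p. 19; §4.3 p. 43] -/
theorem isConj_conj_of_isConj_conj_of_charpoly_separable {t t' x x' : GL n R} (hsep : (t : Matrix n n R).charpoly.Separable)
    (htt' : t' * t = t * t') (hxt : x * t * x⁻¹ ∈ G) (hx't : x' * t * x'⁻¹ ∈ G) (hxt' : x * t' * x⁻¹ ∈ G) (hx't' : x' * t' * x'⁻¹ ∈ G)
    (h : IsConj (⟨x * t * x⁻¹, hxt⟩ : G) ⟨x' * t * x'⁻¹, hx't⟩) : IsConj (⟨x * t' * x⁻¹, hxt'⟩ : G) ⟨x' * t' * x'⁻¹, hx't'⟩ :=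
  isConj_conj_of_isConj_conj G hxt hx't hxt' hx't' (forall_commute_of_charpoly_separable ι hι hsep htt') h

include hι in
/-- **(T-tr-b)**: for two COMMUTING elements `t, t′ ∈ GL_n(R)` with SEPARABLE characteristic polynomials (two regular elements of one torus) and conjugators
`x, x′ ∈ GL_n(R)` with `x t x⁻¹, x′ t x′⁻¹, x t′ x⁻¹, x′ t′ x′⁻¹ ∈ G`: **`x t x⁻¹ ~_G x′ t x′⁻¹ ↔ x t′ x⁻¹ ~_G x′ t′ x′⁻¹`**.
[cite: Rogawski1990, §3.1 p. 19; §4.3 p. 43] -/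
theorem isConj_conj_iff_of_charpoly_separable {t t' x x' : GL n R} (hsep : (t : Matrix n n R).charpoly.Separable)
    (hsep' : (t' : Matrix n n R).charpoly.Separable) (htt' : t' * t = t * t') (hxt : x * t * x⁻¹ ∈ G) (hx't : x' * t * x'⁻¹ ∈ G)
    (hxt' : x * t' * x⁻¹ ∈ G) (hx't' : x' * t' * x'⁻¹ ∈ G) :
    IsConj (⟨x * t * x⁻¹, hxt⟩ : G) ⟨x' * t * x'⁻¹, hx't⟩ ↔ IsConj (⟨x * t' * x⁻¹, hxt'⟩ : G) ⟨x' * t' * x'⁻¹, hx't'⟩ :=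
  isConj_conj_iff_of_forall_commute G hxt hx't hxt' hx't' (forall_commute_of_charpoly_separable ι hι hsep htt')
    (forall_commute_of_charpoly_separable ι hι hsep' htt'.symm)

include hι in
/-- **«The number of `G`-classes met along the torus is the same at `t` and `t′`»**: for a family of conjugators `x_k` with `x_k t x_k⁻¹, x_k t′ x_k⁻¹ ∈ G`,
the enumeration `k ↦ ⟦x_k t x_k⁻¹⟧_G` (★ `ConjClasses.mk` in `↥G`) is injective iff `k ↦ ⟦x_k t′ x_k⁻¹⟧_G` is — `t, t′` commuting, both separable.
[cite: Rogawski1990, §4.3 p. 43] -/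
theorem injective_conjClasses_conj_iff_of_charpoly_separable {κ : Type*} {t t' : GL n R} (hsep : (t : Matrix n n R).charpoly.Separable)
    (hsep' : (t' : Matrix n n R).charpoly.Separable) (htt' : t' * t = t * t') (x : κ → GL n R) (hx : ∀ k, x k * t * (x k)⁻¹ ∈ G)
    (hx' : ∀ k, x k * t' * (x k)⁻¹ ∈ G) :
    Function.Injective (fun k => ConjClasses.mk (⟨x k * t * (x k)⁻¹, hx k⟩ : G)) ↔
      Function.Injective (fun k => ConjClasses.mk (⟨x k * t' * (x k)⁻¹, hx' k⟩ : G)) := by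
  constructor
  · intro hinj k l hkl
    exact hinj (ConjClasses.mk_eq_mk_iff_isConj.2
      ((isConj_conj_iff_of_charpoly_separable ι hι G hsep hsep' htt' (hx k) (hx l) (hx' k) (hx' l)).2 (ConjClasses.mk_eq_mk_iff_isConj.1 hkl)))
  · intro hinj k l hkl
    exact hinj (ConjClasses.mk_eq_mk_iff_isConj.2
      ((isConj_conj_iff_of_charpoly_separable ι hι G hsep hsep' htt' (hx k) (hx l) (hx' k) (hx' l)).1 (ConjClasses.mk_eq_mk_iff_isConj.1 hkl)))

end Head

end Literature.NumberTheory.Rogawski1990.TorusClassRigidity
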